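import Mathlib
import HarnessLib

/-!
# ValiantsHypothesis / LacunarySymmetroid — crux `MatrixDescartes` (stmt-ValiantsHypothesis-18050, V1),
# line `Cruxes/MatrixDescartes/Lines/osculation_law.lean` («osculation-law»), stub `stub_peel` (all ranks `r`):
# THE CUT-AND-COUNT PIGEONHOLE, abstracted

`stub_peel` counts the positive zeros (with multiplicity) of `det(G + c t^N P)` by distributing them on the
eigenvalue branches of the spectral curve, CUTTING each branch at finitely many abscissae (its zeros, its
escapes, its osculation points) and bounding the zeros on every cut-free arc by two (the branch-arc engine
`OsculationPeel.card_roots_filter_branchArc_le_two`).  The passage «≤ B per cut-free arc ⇒ ≤ B·(#cuts + 1) in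
total» was carried out inline at rank one (`OsculationPeel.peel_curve`, steps (4)–(5)); this file isolates it,
for every rank and every branch:

* `card_le_mul_card_cuts_succ` — for a finite multiset `M` of positive reals avoiding a finite cut set `P`, if
  every open interval `(L, U)` (`L ≥ 0`) free of cut points carries at most `B` elements of `M` (with
  multiplicity), then `card M ≤ B · (#P + 1)`.

Proof (adapted from `…OsculationLawPeelRankOneCurve`, steps (4)–(5)): the cut counter `k(t) = #{q ∈ P : q < t}`
takes at most `#P + 1` values on `M`, and a fibre of `k` lies in the cut-free arc from the last cut (or `0`) below
its minimum to the first cut above its maximum.  Honest framing: bookkeeping for an OPEN stub; nothing here bears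
on `stub_peel`, the LAW, `MatrixDescartes` or `VP ≠ VNP`.  No definitions; Mathlib only.
-/

-- `Summit.ValiantsHypothesis.ValiantsHypothesis.…` is the tree's mandated single-conjunct layout (Sub = Summit).
set_option linter.dupNamespace false

noncomputable section

namespace Summit.ValiantsHypothesis.ValiantsHypothesis.Theorems.LacunarySymmetroidMatrixDescartes

open Set
open scoped BigOperators

namespace OsculationPeel

/-- **Cut-and-count.**  Let `M` be a finite multiset of positive reals none of which is a cut point (`P`), and
suppose every cut-free open arc `(L, U)` with `L ≥ 0` carries at most `B` elements of `M` counted with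
multiplicity.  Then `card M ≤ B·(#P + 1)`. [folklore] -/
theorem card_le_mul_card_cuts_succ (M : Multiset ℝ) (P : Finset ℝ) (B : ℕ)
    (hpos : ∀ t ∈ M, 0 < t) (havoid : ∀ t ∈ M, t ∉ P)
    (harc : ∀ L U : ℝ, 0 ≤ L → (∀ q ∈ P, ¬ (L < q ∧ q < U)) →
      Multiset.card (M.filter (fun t => L < t ∧ t < U)) ≤ B) :
    Multiset.card M ≤ B * (P.card + 1) := by
  classical
  -- adapted from `…OsculationLawPeelRankOneCurve` (`peel_curve`, steps (4)–(5))
  set k : ℝ → ℕ := fun t => (P.filter (fun q => q < t)).card with hk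
  have hk_le : ∀ t, k t ≤ P.card := fun t => Finset.card_le_card (Finset.filter_subset _ _)
  -- fibres of the cut counter carry at most `B` elements
  have hfibre : ∀ j : ℕ, Multiset.card (M.filter (fun t => j = k t)) ≤ B := by
    intro j
    set Mj := M.filter (fun t => j = k t) with hMj
    have memMj : ∀ t ∈ Mj, (0 < t ∧ t ∉ P) ∧ j = k t := by
      intro t ht
      rw [hMj, Multiset.mem_filter] at ht
      exact ⟨⟨hpos t ht.1, havoid t ht.1⟩, ht.2⟩
    by_cases hempty : Mj = 0
    · rw [hempty]; simp
    have hDne : Mj.toFinset.Nonempty := by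
      rw [Multiset.toFinset_nonempty]; exact hempty
    set t₁ := Mj.toFinset.min' hDne with ht₁
    set t₂ := Mj.toFinset.max' hDne with ht₂
    have ht₁M : t₁ ∈ Mj := Multiset.mem_toFinset.1 (Finset.min'_mem _ hDne)
    have ht₂M : t₂ ∈ Mj := Multiset.mem_toFinset.1 (Finset.max'_mem _ hDne)
    obtain ⟨⟨ht₁pos, -⟩, hk₁⟩ := memMj t₁ ht₁M
    obtain ⟨⟨_, ht₂P⟩, hk₂⟩ := memMj t₂ ht₂M
    have h12 : t₁ ≤ t₂ := Finset.min'_le _ _ (Finset.max'_mem _ hDne)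
    -- the arc `(L, U)` around `[t₁, t₂]`
    have hLne : ((insert (0 : ℝ) P).filter (fun q => q < t₁)).Nonempty :=
      ⟨0, Finset.mem_filter.2 ⟨Finset.mem_insert_self _ _, ht₁pos⟩⟩
    set L := ((insert (0 : ℝ) P).filter (fun q => q < t₁)).max' hLne with hL
    have hL0 : 0 ≤ L :=
      Finset.le_max' ((insert (0 : ℝ) P).filter (fun q => q < t₁)) 0
        (Finset.mem_filter.2 ⟨Finset.mem_insert_self 0 P, ht₁pos⟩)
    have hLt₁ : L < t₁ := (Finset.mem_filter.1 (Finset.max'_mem _ hLne)).2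
    set U : ℝ := if hU : (P.filter (fun q => t₂ < q)).Nonempty then (P.filter (fun q => t₂ < q)).min' hU
      else t₂ + 1 with hU
    have ht₂U : t₂ < U := by
      rw [hU]; split_ifs with h
      · exact (Finset.mem_filter.1 (Finset.min'_mem _ h)).2
      · linarith
    -- no cut point inside the arc
    have hnoP : ∀ q ∈ P, ¬ (L < q ∧ q < U) := by
      intro q hq ⟨hLq, hqU⟩
      rcases lt_or_ge q t₁ with h1 | h1
      · exact absurd (Finset.le_max' _ q (Finset.mem_filter.2 ⟨Finset.mem_insert_of_mem hq, h1⟩)) (not_le.2 hLq)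
      rcases lt_or_ge t₂ q with h2 | h2
      · have hne : (P.filter (fun q => t₂ < q)).Nonempty := ⟨q, Finset.mem_filter.2 ⟨hq, h2⟩⟩
        rw [hU, dif_pos hne] at hqU
        exact absurd (Finset.min'_le _ q (Finset.mem_filter.2 ⟨hq, h2⟩)) (not_le.2 hqU)
      rcases eq_or_lt_of_le h2 with h3 | h3
      · exact ht₂P (h3 ▸ hq)
      · have hsub : P.filter (fun q => q < t₁) ⊆ P.filter (fun q => q < t₂) := by
          intro x hx
          rw [Finset.mem_filter] at hx ⊢
          exact ⟨hx.1, lt_of_lt_of_le hx.2 h12⟩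
        have hqin : q ∈ P.filter (fun q => q < t₂) := Finset.mem_filter.2 ⟨hq, h3⟩
        have hqout : q ∉ P.filter (fun q => q < t₁) := fun h => not_lt.2 h1 (Finset.mem_filter.1 h).2
        have hlt : (P.filter (fun q => q < t₁)).card < (P.filter (fun q => q < t₂)).card :=
          Finset.card_lt_card ⟨hsub, fun h => hqout (h hqin)⟩
        have : k t₁ < k t₂ := hlt
        omega
    have hB := harc L U hL0 hnoP
    have hle : Mj ≤ M.filter (fun t => L < t ∧ t < U) := by
      refine Multiset.le_filter.2 ⟨Multiset.filter_le _ _, ?_⟩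
      intro t ht
      have ht' : t ∈ Mj.toFinset := Multiset.mem_toFinset.2 ht
      exact ⟨hLt₁.trans_le (Finset.min'_le _ _ ht'), (Finset.le_max' _ _ ht').trans_lt ht₂U⟩
    exact (Multiset.card_le_card hle).trans hB
  -- pigeonhole over the values of the cut counter
  have hsum : Multiset.card M = ∑ j ∈ (M.map k).toFinset, (M.map k).count j := by
    rw [Multiset.toFinset_sum_count_eq, Multiset.card_map]
  have hcount : ∀ j, (M.map k).count j ≤ B := by
    intro j
    rw [Multiset.count_map]
    exact hfibre j
  have hrange : (M.map k).toFinset ⊆ Finset.range (P.card + 1) := by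
    intro j hj
    rw [Multiset.mem_toFinset, Multiset.mem_map] at hj
    obtain ⟨t, -, rfl⟩ := hj
    exact Finset.mem_range.2 (Nat.lt_succ_of_le (hk_le t))
  calc Multiset.card M = ∑ j ∈ (M.map k).toFinset, (M.map k).count j := hsum
    _ ≤ ∑ j ∈ (M.map k).toFinset, B := Finset.sum_le_sum fun j _ => hcount j
    _ = B * (M.map k).toFinset.card := by rw [Finset.sum_const, smul_eq_mul, mul_comm]
    _ ≤ B * (Finset.range (P.card + 1)).card := Nat.mul_le_mul_left _ (Finset.card_le_card hrange)
    _ = B * (P.card + 1) := by rw [Finset.card_range]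

end OsculationPeel

end Summit.ValiantsHypothesis.ValiantsHypothesis.Theorems.LacunarySymmetroidMatrixDescartes

end
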